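import Summits.CriticalPhenomena.SAWScalingLimit.Theorems.SAWStressTensorTMartingaleDriverExpansion
import Summits.CriticalPhenomena.SAWScalingLimit.Theses.SAWStressTensor

/-!
# Route `SAWStressTensor`, item `TMartingaleDriver`: the stress-tensor martingale observable
forces the driving martingales with `κ = 8/3`

Item `stmt-CriticalPhenomena-7753` (support) of route `SAWStressTensor`, sub-problem
`SAWScalingLimit`, PROVED as stated (`tMartingaleDriver_proof`): for a real process `W` indexed
by `ℝ≥0` on a probability space, strongly adapted to a filtration `𝓕`, with continuous paths,
`W_0 = 0` and running supremum on each `[0, t]` dominated by a nonnegative `M ∈ L³`, if for all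
levels `y ≥ y₀` the real and imaginary parts of the stopped stress-tensor observable
`r ↦ (iy g_σ'(iy)/(g_σ(iy) - W_σ))²`, `σ = r ∧ τ_y` (`τ_y = Loewner.farStopTime W y`, the CDHKS
far-field stopping time), are `𝓕`-martingales, then `W_t` and `W_t² - (8/3) t` are
`𝓕`-martingales.

The argument is the tree's `Loewner.martingale_driver_of_fkObservable` (CDHKS 2014 §3 /
Duminil-Copin–Smirnov 2012, proof of Prop. 6.7) run with the expansion of part 1
(`SAWStressTensorTMartingaleDriverExpansion.lean`):
`T = 1 + 2W/z + (3W² - 8t)/z² + O(((M + √t)/y)³)` at `z = iy` gives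
`Im T = -2W/y + O(y⁻³)` and `Re T = 1 - (3W² - 8t)/y² + O(y⁻³)`; hence the stopped driver and
the stopped quadratic term `3W² - 8σ` are approximate martingales with `L¹` defects `O(y⁻²)`,
`O(y⁻¹)` (`integral_abs_condExp_sub_le_of_martingale`), the stopping disappears as `y → ∞`
(dominated convergence), and `Loewner.condExp_ae_eq_of_approx` concludes:
`E[W_t | 𝓕_s] = W_s` and `E[3W_t² - 8t | 𝓕_s] = 3W_s² - 8s`, i.e. `κ = 8/3`. No exponent and no
amplitude enter: any constant multiple of the observable gives the same two identities.

## References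

* D. Chelkak, H. Duminil-Copin, C. Hongler, A. Kemppainen, S. Smirnov, *Convergence of Ising
  interfaces to Schramm's SLE curves*, C. R. Math. 352 (2014), §3 [CDHKSCRAS2014].
* H. Duminil-Copin, S. Smirnov, *Conformal invariance of lattice models*, Clay Math. Proc. 15
  (2012), proof of Prop. 6.7 [DuminilCopinSmirnov2012Clay].
* M. Bauer, D. Bernard, *Conformal field theories of stochastic Loewner evolutions*, Comm. Math.
  Phys. 239 (2003) [BauerBernard2003].
-/

noncomputable section

open Set Filter Topology Metric MeasureTheory Complex
open scoped NNReal
open Literature.Probability.RandomPlanarGeometry Literature.Probability.Process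

namespace Summit.CriticalPhenomena.SAWScalingLimit.Theorems

variable {Ω : Type*} {m : MeasurableSpace Ω} {W : ℝ≥0 → Ω → ℝ} {P : Measure Ω}
  [IsProbabilityMeasure P] {𝓕 : Filtration ℝ≥0 m}

/-- **Order one: the stopped driver is an approximate martingale with defect `O(y⁻²)`.** If the
imaginary part of the stopped stress-tensor observable at `iy` is a martingale, then
`∫ |E[W_{t∧τ_y} | 𝓕_s] - W_{s∧τ_y}| ≤ 221 E[(M + √t)³]/y²`: pathwise
`|W_{r∧τ} - (-(y/2)) Im T_r| ≤ (221/2) (M + √t)³/y²` (`stressTensor_abs_im_stopped_add_le`), and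
`integral_abs_condExp_sub_le_of_martingale`. (CDHKS 2014, §3: the coefficient of `w⁻¹`.)
[cite: CDHKSCRAS2014, §3] -/
theorem stressTensor_integral_abs_condExp_stoppedDriver_sub_le (hWad : StronglyAdapted 𝓕 W)
    (hWc : ∀ ω, Continuous (W · ω)) (hW0 : ∀ ω, W 0 ω = 0) {y : ℝ} (hy : 0 < y)
    (him : Martingale (fun r ω ↦ (stoppedProcess (fun r ω ↦ (I * y *
      deriv (Loewner.map (fun u ↦ W u ω) r) (I * y) /
        (Loewner.map (fun u ↦ W u ω) r (I * y) - W r ω)) ^ 2) (Loewner.farStopTime W y) r ω).im) 𝓕 P)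
    {s t : ℝ≥0} (hst : s ≤ t) {M : Ω → ℝ} (hM : MemLp M 3 P) (hM0 : ∀ ω, 0 ≤ M ω)
    (hbd : ∀ᵐ ω ∂P, ∀ u, u ≤ t → |W u ω| ≤ M ω) :
    ∫ ω, |(P[stoppedProcess W (Loewner.farStopTime W y) t | 𝓕 s]) ω -
        stoppedProcess W (Loewner.farStopTime W y) s ω| ∂P ≤
      221 * (∫ ω, (M ω + Real.sqrt t) ^ 3 ∂P) / y ^ 2 := by
  set τ := Loewner.farStopTime W y with hτ
  set O : ℝ≥0 → Ω → ℂ := stoppedProcess (fun r ω ↦ (I * y *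
      deriv (Loewner.map (fun u ↦ W u ω) r) (I * y) /
        (Loewner.map (fun u ↦ W u ω) r (I * y) - W r ω)) ^ 2) τ with hO
  set C := ∫ ω, (M ω + Real.sqrt t) ^ 3 ∂P with hC
  have hMi : Integrable M P := Loewner.integrable_of_memLp_three hM
  have hCi : Integrable (fun ω ↦ (M ω + Real.sqrt t) ^ 3) P :=
    Loewner.integrable_add_pow_three hM hM0 (Real.sqrt_nonneg _)
  have hOi : ∀ r, Integrable (fun ω ↦ (O r ω).im) P := fun r ↦ him.integrable r
  -- pointwise comparison with the martingale `-(y/2) Im T`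
  have hpt : ∀ r, r ≤ t → ∀ᵐ ω ∂P,
      |stoppedProcess W τ r ω - (-(y / 2) * (O r ω).im + 0)| ≤
        221 / 2 / y ^ 2 * (M ω + Real.sqrt t) ^ 3 := by
    intro r hr
    filter_upwards [hbd] with ω hω
    have h := stressTensor_abs_im_stopped_add_le hWc hW0 hy (hM0 ω) hω hr
    have hid : stoppedProcess W τ r ω - (-(y / 2) * (O r ω).im + 0) =
        (y / 2) * ((O r ω).im + 2 * stoppedProcess W τ r ω / y) := by
      field_simp
      ring
    rw [hid, abs_mul, abs_of_pos (by positivity : (0 : ℝ) < y / 2)]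
    calc y / 2 * |(O r ω).im + 2 * stoppedProcess W τ r ω / y|
        ≤ y / 2 * (221 * ((M ω + Real.sqrt t) / y) ^ 3) := by gcongr
      _ = 221 / 2 / y ^ 2 * (M ω + Real.sqrt t) ^ 3 := by field_simp
  have hint : ∀ r, r ≤ t →
      ∫ ω, |stoppedProcess W τ r ω - (-(y / 2) * (O r ω).im + 0)| ∂P ≤ 221 / 2 / y ^ 2 * C := by
    intro r hr
    calc ∫ ω, |stoppedProcess W τ r ω - (-(y / 2) * (O r ω).im + 0)| ∂P
        ≤ ∫ ω, 221 / 2 / y ^ 2 * (M ω + Real.sqrt t) ^ 3 ∂P :=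
          integral_mono_ae ((Loewner.integrable_stoppedDriver hWad hWc hMi hbd hr y).sub
            (((hOi r).const_mul _).add (integrable_const _))).abs (hCi.const_mul _) (hpt r hr)
      _ = 221 / 2 / y ^ 2 * C := integral_const_mul _ _
  have hmain := integral_abs_condExp_sub_le_of_martingale him (-(y / 2)) 0
    (Loewner.integrable_stoppedDriver hWad hWc hMi hbd le_rfl y)
    (Loewner.integrable_stoppedDriver hWad hWc hMi hbd hst y) hst (hint t le_rfl) (hint s hst)
  calc _ ≤ 2 * (221 / 2 / y ^ 2 * C) := hmain
    _ = 221 * C / y ^ 2 := by ring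

/-- **Order one, assembled: `E[W_t | 𝓕_s] = W_s`** from the martingale property of the imaginary
part of the stopped stress-tensor observable at all large levels `y` (approximate martingale
identity `Loewner.condExp_ae_eq_of_approx` + removal of the stopping,
`Loewner.tendsto_integral_abs_sub_stoppedDriver`). (DCS 2012, p. 29 / CDHKS 2014, §3, for the
spin-2 observable.) [cite: CDHKSCRAS2014, §3] -/
theorem stressTensor_condExp_driver_ae_eq (hWad : StronglyAdapted 𝓕 W)
    (hWc : ∀ ω, Continuous (W · ω)) (hW0 : ∀ ω, W 0 ω = 0) {y₀ : ℝ}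
    (him : ∀ y, y₀ ≤ y → Martingale (fun r ω ↦ (stoppedProcess (fun r ω ↦ (I * y *
      deriv (Loewner.map (fun u ↦ W u ω) r) (I * y) /
        (Loewner.map (fun u ↦ W u ω) r (I * y) - W r ω)) ^ 2) (Loewner.farStopTime W y) r ω).im) 𝓕 P)
    {s t : ℝ≥0} (hst : s ≤ t) {M : Ω → ℝ} (hM : MemLp M 3 P) (hM0 : ∀ ω, 0 ≤ M ω)
    (hbd : ∀ᵐ ω ∂P, ∀ u, u ≤ t → |W u ω| ≤ M ω) :
    P[W t | 𝓕 s] =ᵐ[P] W s := by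
  have hMi : Integrable M P := Loewner.integrable_of_memLp_three hM
  set y₁ : ℝ := max y₀ 1 with hy₁
  set C := ∫ ω, (M ω + Real.sqrt t) ^ 3 ∂P with hC
  have ha := Loewner.tendsto_integral_abs_sub_stoppedDriver hWad hWc hMi hbd le_rfl y₁
  have hb := Loewner.tendsto_integral_abs_sub_stoppedDriver hWad hWc hMi hbd hst y₁
  have hc : Tendsto (fun n : ℕ ↦ 221 * C / (y₁ + n) ^ 2) atTop (𝓝 0) := by
    have h1 : Tendsto (fun n : ℕ ↦ (y₁ + n : ℝ)) atTop atTop :=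
      tendsto_atTop_add_const_left atTop y₁ tendsto_natCast_atTop_atTop
    have h2 : Tendsto (fun n : ℕ ↦ (y₁ + n : ℝ) ^ 2) atTop atTop :=
      (tendsto_pow_atTop two_ne_zero).comp h1
    exact tendsto_const_nhds.div_atTop h2
  refine Loewner.condExp_ae_eq_of_approx (Loewner.integrable_driver hWad hMi hbd le_rfl)
    (Loewner.integrable_driver hWad hMi hbd hst) fun ε hε ↦ ?_
  obtain ⟨n, hna, hnb, hnc⟩ := ((ha.eventually (gt_mem_nhds hε)).and
    ((hb.eventually (gt_mem_nhds hε)).and (hc.eventually (gt_mem_nhds hε)))).exists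
  set y : ℝ := y₁ + n with hy
  have hy0 : 0 < y := by
    have : (1 : ℝ) ≤ y₁ := le_max_right _ _
    positivity
  have hyy : y₀ ≤ y := by
    have : y₀ ≤ y₁ := le_max_left _ _
    have : (0 : ℝ) ≤ n := n.cast_nonneg
    linarith
  refine ⟨stoppedProcess W (Loewner.farStopTime W y) t, stoppedProcess W (Loewner.farStopTime W y) s,
    Loewner.integrable_stoppedDriver hWad hWc hMi hbd le_rfl y,
    Loewner.integrable_stoppedDriver hWad hWc hMi hbd hst y, hna.le, ?_, ?_⟩
  · refine le_trans (le_of_eq (integral_congr_ae (ae_of_all _ fun ω ↦ ?_))) hnb.le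
    exact abs_sub_comm _ _
  · exact (stressTensor_integral_abs_condExp_stoppedDriver_sub_le hWad hWc hW0 hy0 (him y hyy) hst
      hM hM0 hbd).trans hnc.le

omit [IsProbabilityMeasure P] in
/-- The stopped quadratic term `3 W_{r∧τ}² - 8 (r ∧ τ)` is integrable under the moment bound.
[folklore] -/
theorem stressTensor_integrable_stoppedQuad (hWad : StronglyAdapted 𝓕 W)
    (hWc : ∀ ω, Continuous (W · ω)) [IsFiniteMeasure P] {t : ℝ≥0} {M : Ω → ℝ}
    (hM2 : Integrable (fun ω ↦ M ω ^ 2) P)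
    (hbd : ∀ᵐ ω ∂P, ∀ u, u ≤ t → |W u ω| ≤ M ω) {r : ℝ≥0} (hr : r ≤ t) (y : ℝ) :
    Integrable (fun ω ↦ 3 * stoppedProcess W (Loewner.farStopTime W y) r ω ^ 2 -
      8 * (((min (r : WithTop ℝ≥0) (Loewner.farStopTime W y ω)).untopA : ℝ≥0) : ℝ)) P := by
  refine Integrable.sub ?_ ?_
  · refine (hM2.const_mul 3).mono' ?_ ?_
    · exact (((continuous_pow 2).comp_stronglyMeasurable
        (Loewner.stronglyMeasurable_stoppedDriver hWad hWc y r)).const_mul 3).aestronglyMeasurable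
    · filter_upwards [hbd] with ω hω
      have h1 : |stoppedProcess W (Loewner.farStopTime W y) r ω| ≤ M ω :=
        hω ((min (r : WithTop ℝ≥0) (Loewner.farStopTime W y ω)).untopA)
          ((untopA_min_coe_le r _).trans hr)
      rw [Real.norm_eq_abs, abs_of_nonneg (by positivity)]
      have h2 : stoppedProcess W (Loewner.farStopTime W y) r ω ^ 2 ≤ M ω ^ 2 := by
        rw [← sq_abs]; exact pow_le_pow_left₀ (abs_nonneg _) h1 2
      linarith
  · refine (integrable_const (8 * (r : ℝ))).mono' ?_ (ae_of_all _ fun ω ↦ ?_)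
    · exact ((Loewner.stronglyMeasurable_stoppedClock hWad hWc y r).const_mul 8).aestronglyMeasurable
    · rw [Real.norm_eq_abs, abs_mul, abs_of_pos (by norm_num : (0 : ℝ) < 8)]
      gcongr
      rw [NNReal.abs_eq]
      exact_mod_cast untopA_min_coe_le r _

/-- **Order two: the stopped quadratic term is an approximate martingale with defect `O(y⁻¹)`.**
If the real part of the stopped stress-tensor observable at `iy` is a martingale, then with
`Q_r = 3 W_{r∧τ_y}² - 8 (r ∧ τ_y)`, `∫ |E[Q_t | 𝓕_s] - Q_s| ≤ 442 E[(M + √t)³]/y`: pathwise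
`|Q_r - (y² - y² Re T_r)| ≤ 221 (M + √t)³/y` (`stressTensor_abs_re_stopped_sub_le`), and
`integral_abs_condExp_sub_le_of_martingale`. (CDHKS 2014, §3: the coefficient of `w⁻²`; here
`3W² - 8t` in place of the FK `3W² - 16t`.) [cite: CDHKSCRAS2014, §3] -/
theorem stressTensor_integral_abs_condExp_stoppedQuad_sub_le (hWad : StronglyAdapted 𝓕 W)
    (hWc : ∀ ω, Continuous (W · ω)) (hW0 : ∀ ω, W 0 ω = 0) {y : ℝ} (hy : 0 < y)
    (hre : Martingale (fun r ω ↦ (stoppedProcess (fun r ω ↦ (I * y *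
      deriv (Loewner.map (fun u ↦ W u ω) r) (I * y) /
        (Loewner.map (fun u ↦ W u ω) r (I * y) - W r ω)) ^ 2) (Loewner.farStopTime W y) r ω).re) 𝓕 P)
    {s t : ℝ≥0} (hst : s ≤ t) {M : Ω → ℝ} (hM : MemLp M 3 P) (hM0 : ∀ ω, 0 ≤ M ω)
    (hbd : ∀ᵐ ω ∂P, ∀ u, u ≤ t → |W u ω| ≤ M ω) :
    ∫ ω, |(P[fun ω ↦ 3 * stoppedProcess W (Loewner.farStopTime W y) t ω ^ 2 -
          8 * (((min (t : WithTop ℝ≥0) (Loewner.farStopTime W y ω)).untopA : ℝ≥0) : ℝ) | 𝓕 s]) ω -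
        (3 * stoppedProcess W (Loewner.farStopTime W y) s ω ^ 2 -
          8 * (((min (s : WithTop ℝ≥0) (Loewner.farStopTime W y ω)).untopA : ℝ≥0) : ℝ))| ∂P ≤
      442 * (∫ ω, (M ω + Real.sqrt t) ^ 3 ∂P) / y := by
  set τ := Loewner.farStopTime W y with hτ
  set O : ℝ≥0 → Ω → ℂ := stoppedProcess (fun r ω ↦ (I * y *
      deriv (Loewner.map (fun u ↦ W u ω) r) (I * y) /
        (Loewner.map (fun u ↦ W u ω) r (I * y) - W r ω)) ^ 2) τ with hO
  set Q : ℝ≥0 → Ω → ℝ := fun r ω ↦ 3 * stoppedProcess W τ r ω ^ 2 -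
    8 * (((min (r : WithTop ℝ≥0) (τ ω)).untopA : ℝ≥0) : ℝ) with hQ
  set C := ∫ ω, (M ω + Real.sqrt t) ^ 3 ∂P with hC
  have hMi : Integrable M P := Loewner.integrable_of_memLp_three hM
  have hM2 : Integrable (fun ω ↦ M ω ^ 2) P := Loewner.integrable_sq_of_memLp_three hM
  have hQi : ∀ r, r ≤ t → Integrable (Q r) P := fun r hr ↦
    stressTensor_integrable_stoppedQuad hWad hWc hM2 hbd hr y
  have hOi : ∀ r, Integrable (fun ω ↦ (O r ω).re) P := fun r ↦ hre.integrable r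
  have hCi : Integrable (fun ω ↦ (M ω + Real.sqrt t) ^ 3) P :=
    Loewner.integrable_add_pow_three hM hM0 (Real.sqrt_nonneg _)
  have hy2 : 0 < y ^ 2 := by positivity
  -- pointwise comparison with the martingale `y² - y² Re T`
  have hpt : ∀ r, r ≤ t → ∀ᵐ ω ∂P,
      |Q r ω - (-y ^ 2 * (O r ω).re + y ^ 2)| ≤ 221 / y * (M ω + Real.sqrt t) ^ 3 := by
    intro r hr
    filter_upwards [hbd] with ω hω
    have h := stressTensor_abs_re_stopped_sub_le hWc hW0 hy (hM0 ω) hω hr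
    have hid : Q r ω - (-y ^ 2 * (O r ω).re + y ^ 2) =
        y ^ 2 * ((O r ω).re - 1 + Q r ω / y ^ 2) := by
      field_simp
      ring
    rw [hid, abs_mul, abs_of_pos hy2]
    calc y ^ 2 * |(O r ω).re - 1 + Q r ω / y ^ 2|
        ≤ y ^ 2 * (221 * ((M ω + Real.sqrt t) / y) ^ 3) := by gcongr
      _ = 221 / y * (M ω + Real.sqrt t) ^ 3 := by field_simp
  have hint : ∀ r, r ≤ t →
      ∫ ω, |Q r ω - (-y ^ 2 * (O r ω).re + y ^ 2)| ∂P ≤ 221 / y * C := by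
    intro r hr
    calc ∫ ω, |Q r ω - (-y ^ 2 * (O r ω).re + y ^ 2)| ∂P
        ≤ ∫ ω, 221 / y * (M ω + Real.sqrt t) ^ 3 ∂P :=
          integral_mono_ae ((hQi r hr).sub (((hOi r).const_mul _).add (integrable_const _))).abs
            (hCi.const_mul _) (hpt r hr)
      _ = 221 / y * C := integral_const_mul _ _
  have hmain := integral_abs_condExp_sub_le_of_martingale hre (-y ^ 2) (y ^ 2)
    (hQi t le_rfl) (hQi s hst) hst (hint t le_rfl) (hint s hst)
  calc _ ≤ 2 * (221 / y * C) := hmain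
    _ = 442 * C / y := by ring

omit [IsProbabilityMeasure P] in
/-- **Removing the stopping, order two**: `∫ |(3W_r² - 8r) - (3W_{r∧τ}² - 8 (r ∧ τ))| → 0` along
`y = y₁ + n` (dominated by `6M² + 32r`, eventually `0` pointwise by
`Loewner.exists_forall_lt_farStopTime`). [folklore] -/
theorem stressTensor_tendsto_integral_abs_sub_stoppedQuad (hWad : StronglyAdapted 𝓕 W)
    (hWc : ∀ ω, Continuous (W · ω)) [IsFiniteMeasure P] {t : ℝ≥0} {M : Ω → ℝ}
    (hM2 : Integrable (fun ω ↦ M ω ^ 2) P)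
    (hbd : ∀ᵐ ω ∂P, ∀ u, u ≤ t → |W u ω| ≤ M ω) {r : ℝ≥0} (hr : r ≤ t) (y₁ : ℝ) :
    Tendsto (fun n : ℕ ↦ ∫ ω, |(3 * W r ω ^ 2 - 8 * (r : ℝ)) -
      (3 * stoppedProcess W (Loewner.farStopTime W (y₁ + n)) r ω ^ 2 -
        8 * (((min (r : WithTop ℝ≥0) (Loewner.farStopTime W (y₁ + n) ω)).untopA : ℝ≥0) : ℝ))| ∂P)
      atTop (𝓝 0) := by
  have hXm : AEStronglyMeasurable (fun ω ↦ 3 * W r ω ^ 2 - 8 * (r : ℝ)) P :=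
    ((((continuous_pow 2).comp_stronglyMeasurable ((hWad r).mono (𝓕.le r))).const_mul 3).sub
      stronglyMeasurable_const).aestronglyMeasurable
  have hmeas : ∀ n : ℕ, AEStronglyMeasurable (fun ω ↦ |(3 * W r ω ^ 2 - 8 * (r : ℝ)) -
      (3 * stoppedProcess W (Loewner.farStopTime W (y₁ + n)) r ω ^ 2 -
        8 * (((min (r : WithTop ℝ≥0) (Loewner.farStopTime W (y₁ + n) ω)).untopA : ℝ≥0) : ℝ))|) P :=
    fun n ↦ (hXm.sub (stressTensor_integrable_stoppedQuad hWad hWc hM2 hbd hr _).aestronglyMeasurable).norm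
  have hlim := tendsto_integral_of_dominated_convergence (μ := P) (fun ω ↦ 6 * M ω ^ 2 + 32 * r)
    hmeas ((hM2.const_mul 6).add (integrable_const _))
    (fun n ↦ by
      filter_upwards [hbd] with ω hω
      rw [Real.norm_eq_abs, abs_abs]
      set A := stoppedProcess W (Loewner.farStopTime W (y₁ + n)) r ω with hA
      set σ := (min (r : WithTop ℝ≥0) (Loewner.farStopTime W (y₁ + n) ω)).untopA with hσ
      have hσr : (σ : ℝ) ≤ r := by exact_mod_cast untopA_min_coe_le r _
      have hσ0 : (0 : ℝ) ≤ σ := σ.coe_nonneg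
      have h1 : |W r ω| ≤ M ω := hω r hr
      have h2 : |A| ≤ M ω := hω σ ((untopA_min_coe_le r _).trans hr)
      have h1' : W r ω ^ 2 ≤ M ω ^ 2 := by
        rw [← sq_abs]; exact pow_le_pow_left₀ (abs_nonneg _) h1 2
      have h2' : A ^ 2 ≤ M ω ^ 2 := by rw [← sq_abs]; exact pow_le_pow_left₀ (abs_nonneg _) h2 2
      have hr0 : (0 : ℝ) ≤ r := r.coe_nonneg
      rw [abs_le]
      constructor <;> nlinarith [sq_nonneg (W r ω), sq_nonneg A])
    (f := fun _ ↦ 0)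
    (ae_of_all _ fun ω ↦ by
      obtain ⟨Y, hY⟩ := Loewner.exists_forall_lt_farStopTime hWc ω r
      obtain ⟨N, hN⟩ := exists_nat_ge (Y - y₁)
      refine tendsto_atTop_of_eventually_const (i₀ := N) fun n hn ↦ ?_
      have hy : Y ≤ y₁ + n := by
        have : (N : ℝ) ≤ n := by exact_mod_cast hn
        linarith
      have hlt := hY _ hy
      rw [stoppedProcess_eq_of_le hlt.le, min_eq_left hlt.le, untopA_coe, sub_self, abs_zero])
  simpa using hlim

/-- **Order two, assembled: `E[W_t² - (8/3) t | 𝓕_s] = W_s² - (8/3) s`** from the martingale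
property of the real part of the stopped stress-tensor observable at all large levels: the
coefficient `3W² - 8t` is an approximate, hence exact, martingale; divide by `3`. This is where
`κ = 8/3` is forced with no exponent input. (CDHKS 2014 §3 / DCS 2012 p. 29 with `16 ↦ 8`.)
[cite: CDHKSCRAS2014, §3] -/
theorem stressTensor_condExp_sq_driver_ae_eq (hWad : StronglyAdapted 𝓕 W)
    (hWc : ∀ ω, Continuous (W · ω)) (hW0 : ∀ ω, W 0 ω = 0) {y₀ : ℝ}
    (hre : ∀ y, y₀ ≤ y → Martingale (fun r ω ↦ (stoppedProcess (fun r ω ↦ (I * y *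
      deriv (Loewner.map (fun u ↦ W u ω) r) (I * y) /
        (Loewner.map (fun u ↦ W u ω) r (I * y) - W r ω)) ^ 2) (Loewner.farStopTime W y) r ω).re) 𝓕 P)
    {s t : ℝ≥0} (hst : s ≤ t) {M : Ω → ℝ} (hM : MemLp M 3 P) (hM0 : ∀ ω, 0 ≤ M ω)
    (hbd : ∀ᵐ ω ∂P, ∀ u, u ≤ t → |W u ω| ≤ M ω) :
    P[fun ω ↦ W t ω ^ 2 - 8 / 3 * (t : ℝ) | 𝓕 s] =ᵐ[P] fun ω ↦ W s ω ^ 2 - 8 / 3 * (s : ℝ) := by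
  have hMi : Integrable M P := Loewner.integrable_of_memLp_three hM
  have hM2 : Integrable (fun ω ↦ M ω ^ 2) P := Loewner.integrable_sq_of_memLp_three hM
  -- integrability of `3 W_r² - 8 r`
  have hXi : ∀ r, r ≤ t → Integrable (fun ω ↦ 3 * W r ω ^ 2 - 8 * (r : ℝ)) P := by
    intro r hr
    refine Integrable.sub ?_ (integrable_const _)
    refine (hM2.const_mul 3).mono' ?_ ?_
    · exact (((continuous_pow 2).comp_stronglyMeasurable ((hWad r).mono (𝓕.le r))).const_mul
        3).aestronglyMeasurable
    · filter_upwards [hbd] with ω hω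
      rw [Real.norm_eq_abs, abs_of_nonneg (by positivity)]
      have h2 : W r ω ^ 2 ≤ M ω ^ 2 := by
        rw [← sq_abs]; exact pow_le_pow_left₀ (abs_nonneg _) (hω r hr) 2
      linarith
  set y₁ : ℝ := max y₀ 1 with hy₁
  set C := ∫ ω, (M ω + Real.sqrt t) ^ 3 ∂P with hC
  have ha := stressTensor_tendsto_integral_abs_sub_stoppedQuad hWad hWc hM2 hbd le_rfl y₁
  have hb := stressTensor_tendsto_integral_abs_sub_stoppedQuad hWad hWc hM2 hbd hst y₁
  have hc : Tendsto (fun n : ℕ ↦ 442 * C / (y₁ + n)) atTop (𝓝 0) := by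
    have h1 : Tendsto (fun n : ℕ ↦ (y₁ + n : ℝ)) atTop atTop :=
      tendsto_atTop_add_const_left atTop y₁ tendsto_natCast_atTop_atTop
    exact tendsto_const_nhds.div_atTop h1
  have hmain : P[fun ω ↦ 3 * W t ω ^ 2 - 8 * (t : ℝ) | 𝓕 s] =ᵐ[P]
      fun ω ↦ 3 * W s ω ^ 2 - 8 * (s : ℝ) := by
    refine Loewner.condExp_ae_eq_of_approx (hXi t le_rfl) (hXi s hst) fun ε hε ↦ ?_
    obtain ⟨n, hna, hnb, hnc⟩ := ((ha.eventually (gt_mem_nhds hε)).and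
      ((hb.eventually (gt_mem_nhds hε)).and (hc.eventually (gt_mem_nhds hε)))).exists
    set y : ℝ := y₁ + n with hy
    have hy0 : 0 < y := by
      have : (1 : ℝ) ≤ y₁ := le_max_right _ _
      positivity
    have hyy : y₀ ≤ y := by
      have : y₀ ≤ y₁ := le_max_left _ _
      have : (0 : ℝ) ≤ n := n.cast_nonneg
      linarith
    refine ⟨fun ω ↦ 3 * stoppedProcess W (Loewner.farStopTime W y) t ω ^ 2 -
        8 * (((min (t : WithTop ℝ≥0) (Loewner.farStopTime W y ω)).untopA : ℝ≥0) : ℝ),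
      fun ω ↦ 3 * stoppedProcess W (Loewner.farStopTime W y) s ω ^ 2 -
        8 * (((min (s : WithTop ℝ≥0) (Loewner.farStopTime W y ω)).untopA : ℝ≥0) : ℝ),
      stressTensor_integrable_stoppedQuad hWad hWc hM2 hbd le_rfl y,
      stressTensor_integrable_stoppedQuad hWad hWc hM2 hbd hst y, hna.le, ?_, ?_⟩
    · refine le_trans (le_of_eq (integral_congr_ae (ae_of_all _ fun ω ↦ ?_))) hnb.le
      exact abs_sub_comm _ _
    · exact (stressTensor_integral_abs_condExp_stoppedQuad_sub_le hWad hWc hW0 hy0 (hre y hyy) hst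
        hM hM0 hbd).trans hnc.le
  -- divide by `3`
  have hsmul : (fun ω ↦ W t ω ^ 2 - 8 / 3 * (t : ℝ)) =
      (1 / 3 : ℝ) • fun ω ↦ 3 * W t ω ^ 2 - 8 * (t : ℝ) := by
    ext ω; simp; ring
  rw [hsmul]
  filter_upwards [condExp_smul (1 / 3 : ℝ) (fun ω ↦ 3 * W t ω ^ 2 - 8 * (t : ℝ)) (𝓕 s) (μ := P),
    hmain] with ω hω hω'
  rw [hω, Pi.smul_apply, hω', smul_eq_mul]
  ring

/-- **Item `stmt-CriticalPhenomena-7753` (`SAWStressTensor.TMartingaleDriver`), PROVED: the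
stress-tensor martingale observable forces the two driving martingales with `κ = 8/3`.** For a
real process `W` on a probability space, indexed by `ℝ≥0`, strongly adapted to `𝓕`, with
continuous paths, `W_0 = 0`, and running supremum on each `[0, t]` dominated by a nonnegative
`M ∈ L³`: if for all levels `y ≥ y₀` the real and imaginary parts of the stopped stress-tensor
observable `r ↦ (iy g_σ'(iy)/(g_σ(iy) - W_σ))²`, `σ = r ∧ τ_y`, are `𝓕`-martingales, then `W_t`
and `W_t² - (8/3) t` are `𝓕`-martingales — the hypothesis format of Lévy's characterisation /
`isSLELaw_of_isLocalMartingale_driving_of_lt_four` with `κ = 8/3`. The amplitude-free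
identification `κ = 8/(α + 1)` at `α = 2` (Bauer–Bernard 2003), proved as
`Loewner.martingale_driver_of_fkObservable` (CDHKS 2014 §3, DCS 2012 Prop. 6.7) with the
squared-density expansion `T = 1 + 2W/z + (3W² - 8t)/z² + O(α³)`.
[cite: CDHKSCRAS2014, §3] -/
theorem tMartingaleDriver_proof : Theses.SAWStressTensor.TMartingaleDriver := by
  intro Ω mΩ P 𝓕 W hP hWad hWc hW0 hmom y₀
  dsimp only
  intro hre him
  refine ⟨⟨hWad, fun s t hst ↦ ?_⟩, ⟨fun t ↦ ?_, fun s t hst ↦ ?_⟩⟩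
  · obtain ⟨M, hM, hM0, hbd⟩ := hmom t
    exact stressTensor_condExp_driver_ae_eq hWad hWc hW0 him hst hM hM0 hbd
  · exact ((continuous_pow 2).comp_stronglyMeasurable (hWad t)).sub stronglyMeasurable_const
  · obtain ⟨M, hM, hM0, hbd⟩ := hmom t
    exact stressTensor_condExp_sq_driver_ae_eq hWad hWc hW0 hre hst hM hM0 hbd

end Summit.CriticalPhenomena.SAWScalingLimit.Theorems
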